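import Literature.MathematicalPhysics.QuantumFieldTheory.ConformalBootstrap3D.PointKernelTMCell

/-!
# Mono-term positivity cells through the v3 Taylor-model kernel (even spin)

The termwise tail hypothesis `hM` of the point-functional assembly theorems
(`boxExcluded_of_pointCells`, `PCert.boxExcluded_of_kernelV3`) asks, for `E₀ ≤ E < E_T` and
`j + τ ≤ E`, that `0 ≤ φ_s(crossF_s 𝓜_{E,j})` for the HR monomials `𝓜_{E,j} = zMono E j`.
At head level `n_F = 0` the node head sum is exactly the monomial:
`Σ_{q ∈ headSet j 0} A_q(E) Φ(crossF_s 𝓜_{E+n, q.2}) = Φ(crossF_s 𝓜_{E,j})` (`A_{0,j} = 1`,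
`A_{0,j'} = 0` for `j' ≠ j`), and the node heads are non-negative WITHOUT any unitarity condition on
`E`.  Hence the v3 kernel (`PKTM.CellPass`, [cite: HogervorstRychkov2013, §3 eq. (3.6)] minorant +
Taylor models in `E`) run with `ℓ := j`, `n_F := 0` certifies `φ_s(crossF_s 𝓜_{E,j}) ≥ 0` on a cell
`E ∈ [A - h, A + h]`, `s ∈ [s_lo, s_hi]`, for EVEN `j` — a high-order replacement for the first-order
corner boxes of rule (M) (`PointKernelLowerM`), needed where the monomial functional has deep
near-zeros (certificate K34L515: `j = 0`, `E ≈ 55`, value `≈ 10⁻¹³` against terms `≈ 10⁻⁹`).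

Main results: `headG_quad_le_zero` (the quadratic minorant at `n_F = 0` is below
`Φ(crossF_s 𝓜_{Δ,ℓ})`, no unitarity hypothesis), `PKTM.monoPos_of_cellPass` (kernel cell ⇒ mono
positivity on the cell, even `ℓ`).  Odd `j` needs a parity-shifted node model (not in this file).
-/

noncomputable section

namespace Literature.MathematicalPhysics.QuantumFieldTheory.ConformalBootstrap3D

open Real Finset Set PointKernel

/-! ### Head level zero -/

/-- `Σ_{q ∈ headSet ℓ 0} A_q X_q = X_{(0, ℓ)}`: at head level `0` only the block's own monomial
survives (`A_{0,ℓ} = 1`, `A_{0,j} = 0` for `j ≠ ℓ`). [cite: HogervorstRychkov2013, §3 eq. (3.9)] -/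
theorem head_sum_zero (Δ : ℝ) (ℓ : ℕ) (X : ℕ × ℕ → ℝ) :
    ∑ q ∈ headSet ℓ 0, hrCoeff Δ ℓ q.1 q.2 * X q = X (0, ℓ) := by
  simp only [headSet, Finset.sum_product, zero_add, Finset.sum_range_one, add_zero]
  rw [Finset.sum_eq_single ℓ]
  · rw [hrCoeff_zero_self, one_mul]
  · intro j _ hj; rw [hrCoeff_zero_of_ne Δ hj, zero_mul]
  · intro h; exact absurd (Finset.mem_range.2 (Nat.lt_succ_self ℓ)) h

/-- `H(x, y, Δ) ≥ 0` at head level `0` for `x, y ≥ 0` — no unitarity condition (the only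
coefficients are `A_{0,ℓ} = 1` and zeros). [cite: HogervorstRychkov2013, §3 eq. (3.9)] -/
theorem nodeHead_zero_nonneg (ℓ : ℕ) {x y : ℝ} (Δ : ℝ) (hx : 0 ≤ x) (hy : 0 ≤ y) :
    0 ≤ nodeHead ℓ 0 x y Δ := by
  unfold nodeHead
  refine Finset.sum_nonneg fun q hq => mul_nonneg ?_
    (mul_nonneg (Real.rpow_nonneg (mul_nonneg hx hy) _) (zLegendre_nonneg _ hx hy))
  simp only [headSet, Finset.mem_product, Finset.mem_range, zero_add] at hq
  have h1 : q.1 = 0 := by omega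
  by_cases h2 : q.2 = ℓ
  · rw [h1, h2, hrCoeff_zero_self]; exact zero_le_one
  · rw [h1, hrCoeff_zero_of_ne Δ h2]

/-- per node at head level `0`: the quadratic is below the node term at `s = σ + θδ`, with no
condition on `Δ`. [cite: HogervorstRychkov2013, §3 eq. (3.6)] -/
theorem nodeG_quad_le_zero {N : ℕ} (w z zb : Fin N → ℝ)
    (hz : ∀ k, z k ∈ Ioo (0 : ℝ) 1) (hzb : ∀ k, zb k ∈ Ioo (0 : ℝ) 1) (ℓ : ℕ) {σ δ θ Δ : ℝ}
    (hδ : 0 ≤ δ) (hθ : θ ∈ Icc (0 : ℝ) 1) (k : Fin N) :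
    nodeG w z zb ℓ 0 σ δ k 0 Δ + θ * nodeG w z zb ℓ 0 σ δ k 1 Δ + θ ^ 2 * nodeG w z zb ℓ 0 σ δ k 2 Δ ≤
      w k * (((1 - z k) * (1 - zb k)) ^ (σ + θ * δ) * ((z k * zb k) ^ (Δ / 2) * nodeHead ℓ 0 (z k) (zb k) Δ)
        - (z k * zb k) ^ (σ + θ * δ) * (((1 - z k) * (1 - zb k)) ^ (Δ / 2) *
          nodeHead ℓ 0 (1 - z k) (1 - zb k) Δ)) := by
  have hzk := hz k; have hzbk := hzb k
  have hv : 0 < (1 - z k) * (1 - zb k) := mul_pos (by linarith [hzk.2]) (by linarith [hzbk.2])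
  have hu : 0 < z k * zb k := mul_pos hzk.1 hzbk.1
  have hv1 : (1 - z k) * (1 - zb k) ≤ 1 := by nlinarith [hzk.1, hzk.2, hzbk.1, hzbk.2]
  have hu1 : z k * zb k ≤ 1 := by nlinarith [hzk.1, hzk.2, hzbk.1, hzbk.2]
  have hrv : 0 < ((1 - z k) * (1 - zb k)) ^ δ := Real.rpow_pos_of_pos hv δ
  have hru : 0 < (z k * zb k) ^ δ := Real.rpow_pos_of_pos hu δ
  have hrv1 : ((1 - z k) * (1 - zb k)) ^ δ ≤ 1 := Real.rpow_le_one hv.le hv1 hδ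
  have hru1 : (z k * zb k) ^ δ ≤ 1 := Real.rpow_le_one hu.le hu1 hδ
  have hFP : 0 ≤ (z k * zb k) ^ (Δ / 2) * nodeHead ℓ 0 (z k) (zb k) Δ :=
    mul_nonneg (Real.rpow_nonneg hu.le _) (nodeHead_zero_nonneg ℓ Δ hzk.1.le hzbk.1.le)
  have hFM : 0 ≤ ((1 - z k) * (1 - zb k)) ^ (Δ / 2) * nodeHead ℓ 0 (1 - z k) (1 - zb k) Δ :=
    mul_nonneg (Real.rpow_nonneg hv.le _)
      (nodeHead_zero_nonneg ℓ Δ (by linarith [hzk.2]) (by linarith [hzbk.2]))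
  have h1 := qsel_mul_le (c := w k * ((1 - z k) * (1 - zb k)) ^ σ) hrv hrv1 hθ.1 hθ.2 hFP
  have h2 := qsel_mul_le (c := -(w k * (z k * zb k) ^ σ)) hru hru1 hθ.1 hθ.2 hFM
  have hvs : ((1 - z k) * (1 - zb k)) ^ (σ + θ * δ) =
      ((1 - z k) * (1 - zb k)) ^ σ * (((1 - z k) * (1 - zb k)) ^ δ) ^ θ := by
    rw [Real.rpow_add hv, ← Real.rpow_mul hv.le, mul_comm δ θ]
  have hus : (z k * zb k) ^ (σ + θ * δ) = (z k * zb k) ^ σ * ((z k * zb k) ^ δ) ^ θ := by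
    rw [Real.rpow_add hu, ← Real.rpow_mul hu.le, mul_comm δ θ]
  rw [hvs, hus]
  have e : nodeG w z zb ℓ 0 σ δ k 0 Δ + θ * nodeG w z zb ℓ 0 σ δ k 1 Δ +
      θ ^ 2 * nodeG w z zb ℓ 0 σ δ k 2 Δ =
    (w k * ((1 - z k) * (1 - zb k)) ^ σ) *
        (qselCoeff (w k * ((1 - z k) * (1 - zb k)) ^ σ) (((1 - z k) * (1 - zb k)) ^ δ) 0
          + qselCoeff (w k * ((1 - z k) * (1 - zb k)) ^ σ) (((1 - z k) * (1 - zb k)) ^ δ) 1 * θ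
          + qselCoeff (w k * ((1 - z k) * (1 - zb k)) ^ σ) (((1 - z k) * (1 - zb k)) ^ δ) 2 * θ ^ 2) *
        ((z k * zb k) ^ (Δ / 2) * nodeHead ℓ 0 (z k) (zb k) Δ)
      + (-(w k * (z k * zb k) ^ σ)) *
        (qselCoeff (-(w k * (z k * zb k) ^ σ)) ((z k * zb k) ^ δ) 0
          + qselCoeff (-(w k * (z k * zb k) ^ σ)) ((z k * zb k) ^ δ) 1 * θ
          + qselCoeff (-(w k * (z k * zb k) ^ σ)) ((z k * zb k) ^ δ) 2 * θ ^ 2) *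
        (((1 - z k) * (1 - zb k)) ^ (Δ / 2) * nodeHead ℓ 0 (1 - z k) (1 - zb k) Δ) := by
    simp only [nodeG]; ring
  rw [e]
  calc _ ≤ (w k * ((1 - z k) * (1 - zb k)) ^ σ) * (((1 - z k) * (1 - zb k)) ^ δ) ^ θ *
          ((z k * zb k) ^ (Δ / 2) * nodeHead ℓ 0 (z k) (zb k) Δ)
        + (-(w k * (z k * zb k) ^ σ)) * ((z k * zb k) ^ δ) ^ θ *
          (((1 - z k) * (1 - zb k)) ^ (Δ / 2) * nodeHead ℓ 0 (1 - z k) (1 - zb k) Δ) :=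
        add_le_add h1 h2
    _ = _ := by ring

/-- **The minorant at head level zero bounds the monomial functional**: for `s = σ + θδ`,
`θ ∈ [0, 1]`, `δ ≥ 0` and ANY `Δ`,
`G₀(Δ) + θ G₁(Δ) + θ² G₂(Δ) ≤ Φ(crossF_s 𝓜_{Δ,ℓ})`. [cite: HogervorstRychkov2013, §3 eq. (3.6)] -/
theorem headG_quad_le_zero {N : ℕ} (w z zb : Fin N → ℝ)
    (hz : ∀ k, z k ∈ Ioo (0 : ℝ) 1) (hzb : ∀ k, zb k ∈ Ioo (0 : ℝ) 1) (ℓ : ℕ) {σ δ θ Δ : ℝ}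
    (hδ : 0 ≤ δ) (hθ : θ ∈ Icc (0 : ℝ) 1) :
    headG w z zb ℓ 0 σ δ 0 Δ + θ * headG w z zb ℓ 0 σ δ 1 Δ + θ ^ 2 * headG w z zb ℓ 0 σ δ 2 Δ ≤
      pointFunctional w z zb (crossF (σ + θ * δ) (-1) (zMono Δ ℓ)) := by
  have hsum := head_sum_eq_nodes w z zb hz hzb ℓ 0 (σ + θ * δ) Δ
  rw [head_sum_zero Δ ℓ (fun q => pointFunctional w z zb (crossF (σ + θ * δ) (-1)
    (zMono (Δ + (q.1 : ℝ)) q.2)))] at hsum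
  simp only [Nat.cast_zero, add_zero] at hsum
  rw [hsum]
  have e : headG w z zb ℓ 0 σ δ 0 Δ + θ * headG w z zb ℓ 0 σ δ 1 Δ +
      θ ^ 2 * headG w z zb ℓ 0 σ δ 2 Δ =
    ∑ k, (nodeG w z zb ℓ 0 σ δ k 0 Δ + θ * nodeG w z zb ℓ 0 σ δ k 1 Δ +
      θ ^ 2 * nodeG w z zb ℓ 0 σ δ k 2 Δ) := by
    simp only [headG, Finset.mul_sum, ← Finset.sum_add_distrib]
  rw [e]
  exact Finset.sum_le_sum (fun k _ => nodeG_quad_le_zero w z zb hz hzb ℓ hδ hθ k)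

namespace PKTM

/-- **Mono-term positivity from kernel cells (even spin).** The v3 kernel run at head level
`n_F = 0` and spin `ℓ = j` (even): if every `s`-piece of the chain `s_lo = σ_0 ≤ … ≤ σ_P = s_hi`
passes (`CellPass`), then `0 ≤ φ_s(crossF_s 𝓜_{E, j})` for all `s ∈ [s_lo, s_hi]` and all
`E ∈ [A - h, A + h]` — the shape of the termwise tail hypothesis `hM` on that cell, with no
unitarity or twist condition on `E`. [cite: HogervorstRychkov2013, §3 eq. (3.6)] -/
theorem monoPos_of_cellPass {c : PCert} (hc : c.checkNodes = true) {slo shi : ℚ}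
    {t : TMCell} (hD : 1 ≤ t.D) (hK : 0 < t.K) (hℓ : Even t.ℓ) (hnF : t.nF = 0)
    (hpiv : HRTM.pivOK t.A t.ℓ t.e t.nF = true) (hrA : t.rA.ok = true)
    (hA : t.rA.expo c.rho = t.A / 2)
    {ps : List TMPiece} {P : ℕ} (hP : 0 < P) (hch : chainOK c ps P slo shi = true)
    (hpass : ∀ i < P, CellPass c t (pc ps i)) :
    ∀ s ∈ Icc ((slo : ℚ) : ℝ) ((shi : ℚ) : ℝ), ∀ E ∈ Icc ((t.A : ℝ) - t.h) ((t.A : ℝ) + t.h),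
      0 ≤ pointFunctional c.wR c.zR c.zbR (crossF s (-1) (zMono E t.ℓ)) := by
  simp only [chainOK, Bool.and_eq_true, decide_eq_true_eq, List.all_eq_true, List.mem_range] at hch
  obtain ⟨⟨h0, hPσ⟩, hall⟩ := hch
  let σ : ℕ → ℝ := fun i => expoR c (pc ps i).rSig
  have hδ : ∀ i < P, σ (i + 1) - σ i = expoR c (pc ps i).rDel := by
    intro i hi
    obtain ⟨⟨⟨he, -⟩, -⟩, -⟩ := hall i hi
    simp only [σ, expoR, ← he]; push_cast; ring
  have hσ0 : σ 0 = ((slo : ℚ) : ℝ) := by simp only [σ, expoR, h0]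
  have hσP : σ P = ((shi : ℚ) : ℝ) := by simp only [σ, expoR, hPσ]
  intro s hs E hE
  obtain ⟨i, hi, hsi⟩ := exists_piece_Icc σ P hP s ⟨by rw [hσ0]; exact hs.1, by rw [hσP]; exact hs.2⟩
  obtain ⟨⟨⟨-, hd⟩, hrS⟩, hrD⟩ := hall i hi
  have hd' : (0 : ℝ) ≤ expoR c (pc ps i).rDel := by unfold expoR; exact_mod_cast hd
  have hsi' : s ∈ Icc (σ i) (σ i + expoR c (pc ps i).rDel) := by
    rw [← hδ i hi, show σ i + (σ (i + 1) - σ i) = σ (i + 1) by ring]; exact hsi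
  obtain ⟨θ, hθ, hsθ⟩ := exists_boxCoord hsi'
  have hs' : σ i + θ * expoR c (pc ps i).rDel = s := by rw [hsθ]; ring
  obtain ⟨gs, hparts, hnum⟩ := hpass i hi
  have hq := headG_nonneg_of_cellNumber hc hD hK hℓ hpiv hrA hrS hrD hA hparts hnum E hE θ hθ
  rw [hnF] at hq
  have hle := headG_quad_le_zero c.wR c.zR c.zbR (zR_mem_Ioo hc) (zbR_mem_Ioo hc) t.ℓ
    (σ := σ i) (Δ := E) hd' hθ
  rw [hs'] at hle
  exact hq.trans hle

end PKTM

end Literature.MathematicalPhysics.QuantumFieldTheory.ConformalBootstrap3D
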